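import Literature.NumberTheory.Rogawski1990.LocalTransferCentralSingularCompactPackageCM   -- ★ p842393 A-p14 (g28): the S1 compact-side PACKAGE at a central point (`∃ C′ ‹instances› ν′ P″ m′ εC, hD′ ∧ hΔ′ ∧ hcnt` over ★ A-p17 (g21) p842329∕p842198) — read here at `ε♭ = τ b₀`
import Literature.NumberTheory.Rogawski1990.LocalTransferTorusCompactSideVanishingCM      -- ★ p842308 F0P3-p01 (g13): `exists_nhds_finsum_side_eq_zero_of_compact_dock` (`hI0 ⟸ hD0′ + hΔ0`)
import Literature.NumberTheory.Rogawski1990.LocalTransferTorusCompactSideKappaSumCM       -- ★ F0P3-p01 (g13) (c′) FILE B: `exists_nhds_finsum_badSide_delta_eq_zero` (`hΔ0 ⟸ hsep′ hside hdisj halt hall`)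
import Literature.NumberTheory.Rogawski1990.FinExplicitTransferFactorKappaSumZero          -- ★ p842405 F0P3-p01 (g13) (c′) FILE A: `finsum_finExplicitCollection_Δ_coe_out_eq_zero_of_torusFrame` (`hall`)
import Literature.NumberTheory.Rogawski1990.LocalTransferTorusKappaAlternationCM           -- ★ p842395 F0P3-p02 (g12): `exists_nhds_stableClass_pair_delta_dock_eq_neg_of_frame` (`halt`)
import Literature.NumberTheory.Rogawski1990.LocalEndoscopicDockSeparation                  -- ★ p841863 F0P3-p01 (g12): `exists_nhds_stablySaturated_sep_dock` (`hsep′`)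
import Literature.NumberTheory.Rogawski1990.LocalNormFibreBlockDichotomyDock               -- ★ p841689 p08 (g13): `side_of_dock` ∕ `disj_of_dock` (`hside` ∕ `hdisj`)
import Literature.NumberTheory.Rogawski1990.FinExplicitTransferFactorTorusDockSplit        -- ★ p842204 B-p08 (g27): `isConj_endoGL_of_frames` (the norm-pair transport `ι(↑t) ∼ ι(τ t)`)
import HarnessLib

/-!
# THE COMPACT-SIDE PACKAGE of the (S2) germ at the `H`-regular, `G`-singular point `ε_H = (A_{a,b}, a)` — `stub_N6nsS2hI0` of the line «N6nsGerm» PROVED: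
# near the torus base, the `Δ‴_v`-weighted orbital integrals over the BAD side `Q′ t` sum to ZERO (Rogawski 1990, Prop. 8.2.1 (c))

Topic `NumberTheory/Rogawski1990`; namespace `Literature.NumberTheory.Rogawski1990`.  THEOREMS ONLY (no definition, no instance, no notation, no named fact, no `sorry`).
Cell `pub/hodgecm-mathlib` (D-0151), crux H413 = stmt-HodgeConjecture-24833, floor-2 line «N6nsGerm» `Cruxes/H413/Lines/F0_P3a_N6nsGerm.lean`, stub `stub_N6nsS2hI0`
(ED. 1.5 ∕ 1.5′ ∕ 1.5″, pen F0P2-p02 (g8)); LEAD F0P3a-plan (g9) WORD T8-164 «A-p17 (g22) = THE S2 PACKAGE»; seat A-p17 (g22).  Twin of ★ A-p14 (g28)'s S1 package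
`LocalTransferCentralSingularCompactPackageCM` (p842393).  HONEST LABEL: HC_CM is proved only modulo the printed citations (the 2 remaining named inputs hLiu418, h413) until
rung 0 closes; this file is ASSEMBLY over ★ bricks of F0P3-p01 (g13), F0P3-p02 (g12), F0P3a-p08 (g13∕g14), B-p08 (g27), A-p14 (g28), A-p16 (g26), B-p04 (g34), A-p17 (g21) — it
pays no printed statement; it closes `stub_N6nsS2hI0` (1.5″ text) with NO residual hypothesis.

THE MATHEMATICS (Prop. 8.2.1 (c)).  `ε_H = (A_{a,b}, a) ∈ H_v = U(Φ₂)_v × U(Φ₁)_v` is `H`-regular and `G`-singular; `t` runs over the torus `Z_{H_v}(ε_H)` near the base point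
`b₀` (`↑b₀ = ε_H`).  The torus transport `τ` (★ `exists_torusTransport_frame`) sends `b₀` to the CENTRAL point `ε♭ = τ b₀ = (a·1₂, b)` (`b ≠ a`) of the (S1) type; there the
central dock `θ : H_v ≃ Z_{G′_v}(ε)` (`θ z = y·ι_v(z)·y⁻¹`, `ᵗ(σy) H′_v y = a₀·Φ₃`) and a BAD frame `P′` on it (`det G₁′ ∉ det G₁ · N(E_w^×)`) are given.  The bad side at `t` is
`Q′ t γ′ :↔ (τ t G-regular) ∧ ∃ x B, (x γ′ x⁻¹)·P′ = P′·(B ⊕ᶠ (τ t)₂)`.  CLAIM (`hI0`): for every `ψ ∈ C_c^∞(G′_v)`, near `b₀`,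
`Σᶠ_{c : Q′ t (out c)} Δ‴_v(↑t, out c) · Φ(c, ψ; m_G) = 0`.  PROOF = ★ `exists_nhds_finsum_side_eq_zero_of_compact_dock` (F0P3-p01) fed with:
* the COMPACT DOCK `C′` at the framed second class `ε′ = P′(a·1₂ ⊕ᶠ b)P′⁻¹`, with Haar `ν′`, `P″`, a canonical family `m′`, base point `ε_C`, and the descent `hD′` of the matched
  `P′`-framed orbital integrals near `ε♭` — ALL read off ★ A-p14's S1 package `exists_compactSidePackage_of_badFrame` applied AT `ε♭` (its `hΔ′`, `hcnt` conjuncts are not used);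
* `hD0′` — `hD′` pulled back along the continuous `τ` (`τ⁻¹ V ∈ 𝓝 b₀`), the matching moved from `↑t` to `τ t` by `ι(↑t) ∼_{GL₃} ι(τ t)` (★ `isConj_endoGL_of_frames`; the device of
  ★ p08 (g14) `exists_isLocallyConstant_descent_secondClass_torus`);
* `hΔ0` — ★ F0P3-p01's «ALL − GOOD» junction `exists_nhds_finsum_badSide_delta_eq_zero` with `hsep′` := ★ `exists_nhds_stablySaturated_sep_dock` at `ε♭`, `hside`∕`hdisj` := ★
  `side_of_dock`∕`disj_of_dock` at the base element `τ t` (again through `ι(↑t) ∼ ι(τ t)`), `halt` := ★ F0P3-p02's (J2a) head `exists_nhds_stableClass_pair_delta_dock_eq_neg_of_frame`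
  (this is where the dock's FORM relation `ha₀ hy` is consumed — ED. 1.5″ rider (h3)), `hall` := ★ FILE A `finsum_finExplicitCollection_Δ_coe_out_eq_zero_of_torusFrame` at every
  `G`-regular torus point.
So `stub_N6nsS2hI0 := exists_nhds_finsum_badSide_orbitalIntegral_eq_zero_of_badFrame` (ED. 1.6: one token), and with ★ p842393 (S1pkg) and ★ p842395 (S2halt) the line's open
content is {`stub_N6nsR2EP` (R2), `stub_N6nsR1LL` (R1), `stub_N6nsS3`} — three print rows.

* §1 private plumbing (non-degeneracy of an anisotropic `H′`; the prime above a non-split `v` is conjugation-fixed).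
* §2 HEAD **`exists_nhds_finsum_badSide_orbitalIntegral_eq_zero_of_badFrame`** — statement = `stub_N6nsS2hI0`'s text VERBATIM (ED. 1.5″: the stub's ∀-prefix, the (T) torus data,
  the (D) dock WITH its form relation `{a₀} (ha₀) (hy)`, the (F) bad frame; sliced from the candidate 91570353d8be18ee by script), conclusion = ★ p841663's `hI0`.

## References
* [Rogawski1990] J. D. Rogawski, *Automorphic Representations of Unitary Groups in Three Variables*, Ann. of Math. Stud. 123 (1990): §8.2 Prop. 8.2.1 (c) pp. 113–115, (a)(d)
  p. 112 (the classes through the scalar partner); §8.1 Prop. 8.1.3 pp. 110–111 (frames, blocks); §4.3 (4.3.1)–(4.3.2) p. 43 (canonical measures, κ-sums); §3.8 Prop. 3.8.1 (a)(d)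
  pp. 27–30 (anisotropic unitary groups are compact).
* [LanglandsShelstad1990Descent] R. P. Langlands, D. Shelstad, *Descent for transfer factors*, The Grothendieck Festschrift II (1990): Thm. 2.3.A, §2.4 (equisingular descent).
* [LabesseLanglands1979] J.-P. Labesse, R. P. Langlands, *L-indistinguishability for SL(2)*, Canad. J. Math. 31 (1979): §2 (the rank-one κ-alternation).
* [HarishChandra1970] Harish-Chandra (van Dijk), *Harmonic Analysis on Reductive p-adic Groups*, LNM 162 (1970), Part I §3 Lemmas 19–21 (descent).
-/

set_option autoImplicit false

noncomputable section

open NumberField IsDedekindDomain MeasureTheory Measure Topology Filter Matrix Set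
open Literature.NumberTheory.Automorphic Literature.NumberTheory.GaloisRepresentations
open Literature.AlgebraicGeometry.ShimuraVarieties (unitaryGroup hermForm)
open scoped MatrixGroups

namespace Literature.NumberTheory.Rogawski1990

/-! ## §1 Plumbing -/

section CM

variable (L : Type) [Field L] [NumberField L] [IsCMField L]

/-- An anisotropic hermitian matrix is invertible (local copy of ★ `det_ne_zero_of_anisotropic`). [cite: Rogawski1990, §3.8 Prop. 3.8.1 (a) p. 27] -/
private theorem det_ne_zero_of_anisotropic₁₁ {H : Matrix (Fin 3) (Fin 3) L}
    (hH0 : ∀ x : Fin 3 → L, hermForm (cmConjRingHom L) H x x = 0 → x = 0) : H.det ≠ 0 := by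
  intro hdet
  obtain ⟨x, hx, hHx⟩ := Matrix.exists_mulVec_eq_zero_iff.mpr hdet
  refine hx (hH0 x ?_)
  rw [Literature.AlgebraicGeometry.ShimuraVarieties.hermForm, hHx, dotProduct_zero]

/-- At a place with ONE prime of `L` above it, that prime is fixed by complex conjugation (local copy of ★ `smul_eq_of_subsingleton_placesOver`).
[cite: CasselsFrohlichANT1967, Ch. VII Prop. 1.2 (ii)] -/
private theorem smul_eq_of_subsingleton_placesOver₁₁ {v : HeightOneSpectrum (𝓞 ↥(maximalRealSubfield L))}
    (hv : Subsingleton (UnitaryGroup.PlacesOver L v)) (w : UnitaryGroup.PlacesOver L v) : IsCMField.complexConj L • w.1 = w.1 := by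
  have hmem : (IsCMField.complexConj L • w.1).under (𝓞 ↥(maximalRealSubfield L)) = v := by
    rw [HeightOneSpectrum.under_algEquiv_smul]; exact w.2
  exact congrArg Subtype.val (Subsingleton.elim (⟨IsCMField.complexConj L • w.1, hmem⟩ : UnitaryGroup.PlacesOver L v) w)

end CM

/-! ## §2 The head -/

open scoped Classical in
/-- **THE COMPACT-SIDE PACKAGE AT THE TORUS BASE — `stub_N6nsS2hI0` of «N6nsGerm» (ED. 1.5″) PROVED**: at the `H`-regular, `G`-singular `ε_H` (non-split `v`), with the torus
transport `τ` (`τ b₀ = ε♭` central of type (S1)), the central dock `θ` at `ε♭` WITH its form relation, and a bad frame `P′` on it: for every `ψ ∈ C_c^∞(G′_v)` there is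
`V ∈ 𝓝 b₀` such that for `t ∈ V` with `↑t` `G`-regular, `Σᶠ_{c : Q′ t (out c)} Δ‴_v(↑t, out c)·Φ(c, ψ; m_G) = 0` for the bad side
`Q′ t γ′ :↔ IsLocalGRegular (τ t) ∧ ∃ x B, (x γ′ x⁻¹)·P′ = P′·(B ⊕ᶠ (τ t)₂)`.  Statement = the stub's text verbatim; proof = ★ `exists_nhds_finsum_side_eq_zero_of_compact_dock` over
★ A-p14's S1 package at `ε♭` (compact dock `C′`, `hD′`) transported along `τ` (`hD0′`) and ★ F0P3-p01's «ALL − GOOD» junction (`hΔ0`; `halt` ★ F0P3-p02, `hall` ★ FILE A,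
`hsep′` ★, `hside`∕`hdisj` ★ at the base element `τ t`).  See the module docstring.
[cite: Rogawski1990, §8.2 Prop. 8.2.1 (c) pp. 113–115; §8.1 Prop. 8.1.3 pp. 110–111; §4.3 (4.3.1)–(4.3.2) p. 43] [cite: LanglandsShelstad1990Descent, Thm. 2.3.A, §2.4] [cite: LabesseLanglands1979, §2] -/
theorem exists_nhds_finsum_badSide_orbitalIntegral_eq_zero_of_badFrame :
    ∀ (L : Type) [Field L] [NumberField L] [IsCMField L] (H' : Matrix (Fin 3) (Fin 3) L) (μ : HeckeCharacter L)
      [∀ v : HeightOneSpectrum (𝓞 ↥(maximalRealSubfield L)),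
        MeasurableSpace ((UnitaryGroup.cmDatum L 2 (Matrix.of fun i j : Fin 2 => if i.val + j.val + 1 = 2 then (1 : L) else 0)).Local v ×
          (UnitaryGroup.cmDatum L 1 (Matrix.of fun i j : Fin 1 => if i.val + j.val + 1 = 1 then (1 : L) else 0)).Local v)]
      [∀ v : HeightOneSpectrum (𝓞 ↥(maximalRealSubfield L)),
        BorelSpace ((UnitaryGroup.cmDatum L 2 (Matrix.of fun i j : Fin 2 => if i.val + j.val + 1 = 2 then (1 : L) else 0)).Local v ×
          (UnitaryGroup.cmDatum L 1 (Matrix.of fun i j : Fin 1 => if i.val + j.val + 1 = 1 then (1 : L) else 0)).Local v)]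
      [∀ v : HeightOneSpectrum (𝓞 ↥(maximalRealSubfield L)), MeasurableSpace ((UnitaryGroup.cmDatum L 3 H').Local v)]
      [∀ v : HeightOneSpectrum (𝓞 ↥(maximalRealSubfield L)), BorelSpace ((UnitaryGroup.cmDatum L 3 H').Local v)]
      (νH : ∀ v : HeightOneSpectrum (𝓞 ↥(maximalRealSubfield L)),
        Measure ((UnitaryGroup.cmDatum L 2 (Matrix.of fun i j : Fin 2 => if i.val + j.val + 1 = 2 then (1 : L) else 0)).Local v ×
          (UnitaryGroup.cmDatum L 1 (Matrix.of fun i j : Fin 1 => if i.val + j.val + 1 = 1 then (1 : L) else 0)).Local v))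
      (νG : ∀ v : HeightOneSpectrum (𝓞 ↥(maximalRealSubfield L)), Measure ((UnitaryGroup.cmDatum L 3 H').Local v))
      [∀ v, (νH v).IsHaarMeasure] [∀ v, (νH v).IsMulRightInvariant] [∀ v, (νG v).IsHaarMeasure] [∀ v, (νG v).IsMulRightInvariant],
      μ.IsUnitary →
      (∀ x : ideleGroup ↥(maximalRealSubfield L), μ (AdeleRing.ideleBaseChange (↥(maximalRealSubfield L)) L x) = quadraticHeckeCharCM L x) →
      (H'.map (cmConjRingHom L)).transpose = H' →
      (∀ x : Fin 3 → L, hermForm (cmConjRingHom L) H' x x = 0 → x = 0) →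
      ∀ (v : HeightOneSpectrum (𝓞 ↥(maximalRealSubfield L))), Subsingleton (UnitaryGroup.PlacesOver L v) →
      ∀ [_iH : ∀ a : ((UnitaryGroup.cmDatum L 2 (Matrix.of fun i j : Fin 2 => if i.val + j.val + 1 = 2 then (1 : L) else 0)).Local v × (UnitaryGroup.cmDatum L 1 (Matrix.of fun i j : Fin 1 => if i.val + j.val + 1 = 1 then (1 : L) else 0)).Local v),
          MeasurableSpace (((UnitaryGroup.cmDatum L 2 (Matrix.of fun i j : Fin 2 => if i.val + j.val + 1 = 2 then (1 : L) else 0)).Local v × (UnitaryGroup.cmDatum L 1 (Matrix.of fun i j : Fin 1 => if i.val + j.val + 1 = 1 then (1 : L) else 0)).Local v) ⧸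
            Subgroup.centralizer ({a} : Set ((UnitaryGroup.cmDatum L 2 (Matrix.of fun i j : Fin 2 => if i.val + j.val + 1 = 2 then (1 : L) else 0)).Local v × (UnitaryGroup.cmDatum L 1 (Matrix.of fun i j : Fin 1 => if i.val + j.val + 1 = 1 then (1 : L) else 0)).Local v)))]
        [_bH : ∀ a : ((UnitaryGroup.cmDatum L 2 (Matrix.of fun i j : Fin 2 => if i.val + j.val + 1 = 2 then (1 : L) else 0)).Local v × (UnitaryGroup.cmDatum L 1 (Matrix.of fun i j : Fin 1 => if i.val + j.val + 1 = 1 then (1 : L) else 0)).Local v),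
          BorelSpace (((UnitaryGroup.cmDatum L 2 (Matrix.of fun i j : Fin 2 => if i.val + j.val + 1 = 2 then (1 : L) else 0)).Local v × (UnitaryGroup.cmDatum L 1 (Matrix.of fun i j : Fin 1 => if i.val + j.val + 1 = 1 then (1 : L) else 0)).Local v) ⧸
            Subgroup.centralizer ({a} : Set ((UnitaryGroup.cmDatum L 2 (Matrix.of fun i j : Fin 2 => if i.val + j.val + 1 = 2 then (1 : L) else 0)).Local v × (UnitaryGroup.cmDatum L 1 (Matrix.of fun i j : Fin 1 => if i.val + j.val + 1 = 1 then (1 : L) else 0)).Local v)))]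
        [_iG : ∀ γ : ((UnitaryGroup.cmDatum L 3 H').Local v), MeasurableSpace (((UnitaryGroup.cmDatum L 3 H').Local v) ⧸ Subgroup.centralizer ({γ} : Set ((UnitaryGroup.cmDatum L 3 H').Local v)))]
        [_bG : ∀ γ : ((UnitaryGroup.cmDatum L 3 H').Local v), BorelSpace (((UnitaryGroup.cmDatum L 3 H').Local v) ⧸ Subgroup.centralizer ({γ} : Set ((UnitaryGroup.cmDatum L 3 H').Local v)))]
        (mH : OrbitalMeasureFamily ((UnitaryGroup.cmDatum L 2 (Matrix.of fun i j : Fin 2 => if i.val + j.val + 1 = 2 then (1 : L) else 0)).Local v × (UnitaryGroup.cmDatum L 1 (Matrix.of fun i j : Fin 1 => if i.val + j.val + 1 = 1 then (1 : L) else 0)).Local v))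
        (mG : OrbitalMeasureFamily ((UnitaryGroup.cmDatum L 3 H').Local v)),
      mH.IsCanonical (IsLocalGRegular L v) (νH v) → mG.IsCanonical (fun γ => IsRegularElt (γ.val : GL (Fin 3) (UnitaryGroup.LocalRing L v))) (νG v) →
      ∀ (φ : ((UnitaryGroup.cmDatum L 3 H').Local v) → ℂ), IsLocSmooth φ →
      ∀ (εH : ((UnitaryGroup.cmDatum L 2 (Matrix.of fun i j : Fin 2 => if i.val + j.val + 1 = 2 then (1 : L) else 0)).Local v × (UnitaryGroup.cmDatum L 1 (Matrix.of fun i j : Fin 1 => if i.val + j.val + 1 = 1 then (1 : L) else 0)).Local v)), ¬ IsLocalGRegular L v εH →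
        IsRegularElt (εH.1.val : GL (Fin 2) (UnitaryGroup.LocalRing L v)) →
        ∀
    (εf : ((UnitaryGroup.cmDatum L 2 (Matrix.of fun i j : Fin 2 => if i.val + j.val + 1 = 2 then (1 : L) else 0)).Local v × (UnitaryGroup.cmDatum L 1 (Matrix.of fun i j : Fin 1 => if i.val + j.val + 1 = 1 then (1 : L) else 0)).Local v)) (τ : ↥(Subgroup.centralizer ({εH} : Set ((UnitaryGroup.cmDatum L 2 (Matrix.of fun i j : Fin 2 => if i.val + j.val + 1 = 2 then (1 : L) else 0)).Local v × (UnitaryGroup.cmDatum L 1 (Matrix.of fun i j : Fin 1 => if i.val + j.val + 1 = 1 then (1 : L) else 0)).Local v))) → ((UnitaryGroup.cmDatum L 2 (Matrix.of fun i j : Fin 2 => if i.val + j.val + 1 = 2 then (1 : L) else 0)).Local v × (UnitaryGroup.cmDatum L 1 (Matrix.of fun i j : Fin 1 => if i.val + j.val + 1 = 1 then (1 : L) else 0)).Local v)) (hτc : Continuous τ) (hτ₀ : τ ⟨εH, Subgroup.mem_centralizer_singleton_iff.2 rfl⟩ = εf)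
    (hεf₁ : (εf.1.val.val : Matrix (Fin 2) (Fin 2) (UnitaryGroup.LocalRing L v)) = finGammaTwo L v εH • (1 : Matrix (Fin 2) (Fin 2) (UnitaryGroup.LocalRing L v)))
    (hεfu : finGammaTwo L v εf ≠ finGammaTwo L v εH)
    (hτreg : ∀ t : ↥(Subgroup.centralizer ({εH} : Set ((UnitaryGroup.cmDatum L 2 (Matrix.of fun i j : Fin 2 => if i.val + j.val + 1 = 2 then (1 : L) else 0)).Local v × (UnitaryGroup.cmDatum L 1 (Matrix.of fun i j : Fin 1 => if i.val + j.val + 1 = 1 then (1 : L) else 0)).Local v))), IsLocalGRegular L v (t : ((UnitaryGroup.cmDatum L 2 (Matrix.of fun i j : Fin 2 => if i.val + j.val + 1 = 2 then (1 : L) else 0)).Local v × (UnitaryGroup.cmDatum L 1 (Matrix.of fun i j : Fin 1 => if i.val + j.val + 1 = 1 then (1 : L) else 0)).Local v)) → IsLocalGRegular L v (τ t))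
    (hτC : ∀ t : ↥(Subgroup.centralizer ({εH} : Set ((UnitaryGroup.cmDatum L 2 (Matrix.of fun i j : Fin 2 => if i.val + j.val + 1 = 2 then (1 : L) else 0)).Local v × (UnitaryGroup.cmDatum L 1 (Matrix.of fun i j : Fin 1 => if i.val + j.val + 1 = 1 then (1 : L) else 0)).Local v))), τ t ∈ Subgroup.centralizer ({εH} : Set ((UnitaryGroup.cmDatum L 2 (Matrix.of fun i j : Fin 2 => if i.val + j.val + 1 = 2 then (1 : L) else 0)).Local v × (UnitaryGroup.cmDatum L 1 (Matrix.of fun i j : Fin 1 => if i.val + j.val + 1 = 1 then (1 : L) else 0)).Local v)))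
    (P : GL (Fin 2) (UnitaryGroup.LocalRing L v)) (dg : Fin 2 → (UnitaryGroup.LocalRing L v))
    (hP : (εH.1.val.val : Matrix (Fin 2) (Fin 2) (UnitaryGroup.LocalRing L v)) * P.val = P.val * Matrix.diagonal dg) (hdg0 : dg 0 = finGammaTwo L v εH) (hdg01 : dg 0 ≠ dg 1)
    (ht1 : ∀ t : ↥(Subgroup.centralizer ({εH} : Set ((UnitaryGroup.cmDatum L 2 (Matrix.of fun i j : Fin 2 => if i.val + j.val + 1 = 2 then (1 : L) else 0)).Local v × (UnitaryGroup.cmDatum L 1 (Matrix.of fun i j : Fin 1 => if i.val + j.val + 1 = 1 then (1 : L) else 0)).Local v))), (t.1.1.val.val : Matrix (Fin 2) (Fin 2) (UnitaryGroup.LocalRing L v)) * P.val = P.val * Matrix.diagonal ![(P⁻¹.val * t.1.1.val.val * P.val) 0 0, (P⁻¹.val * t.1.1.val.val * P.val) 1 1])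
    (hτ1 : ∀ t : ↥(Subgroup.centralizer ({εH} : Set ((UnitaryGroup.cmDatum L 2 (Matrix.of fun i j : Fin 2 => if i.val + j.val + 1 = 2 then (1 : L) else 0)).Local v × (UnitaryGroup.cmDatum L 1 (Matrix.of fun i j : Fin 1 => if i.val + j.val + 1 = 1 then (1 : L) else 0)).Local v))), ((τ t).1.val.val : Matrix (Fin 2) (Fin 2) (UnitaryGroup.LocalRing L v)) * P.val = P.val * Matrix.diagonal ![(P⁻¹.val * t.1.1.val.val * P.val) 0 0, finGammaTwo L v t.1])
    (hτ2 : ∀ t : ↥(Subgroup.centralizer ({εH} : Set ((UnitaryGroup.cmDatum L 2 (Matrix.of fun i j : Fin 2 => if i.val + j.val + 1 = 2 then (1 : L) else 0)).Local v × (UnitaryGroup.cmDatum L 1 (Matrix.of fun i j : Fin 1 => if i.val + j.val + 1 = 1 then (1 : L) else 0)).Local v))), ((τ t).2.val.val : Matrix (Fin 1) (Fin 1) (UnitaryGroup.LocalRing L v)) = ((P⁻¹.val * t.1.1.val.val * P.val) 1 1) • (1 : Matrix (Fin 1) (Fin 1) (UnitaryGroup.LocalRing L v)))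
    (ε : ((UnitaryGroup.cmDatum L 3 H').Local v)) (y : GL (Fin 3) (UnitaryGroup.LocalRing L v)) (θ : ((UnitaryGroup.cmDatum L 2 (Matrix.of fun i j : Fin 2 => if i.val + j.val + 1 = 2 then (1 : L) else 0)).Local v × (UnitaryGroup.cmDatum L 1 (Matrix.of fun i j : Fin 1 => if i.val + j.val + 1 = 1 then (1 : L) else 0)).Local v) ≃ₜ* ↥(Subgroup.centralizer ({ε} : Set ((UnitaryGroup.cmDatum L 3 H').Local v)))) (hθε : (θ εf).1 = ε)
    (hθ : ∀ z : ((UnitaryGroup.cmDatum L 2 (Matrix.of fun i j : Fin 2 => if i.val + j.val + 1 = 2 then (1 : L) else 0)).Local v × (UnitaryGroup.cmDatum L 1 (Matrix.of fun i j : Fin 1 => if i.val + j.val + 1 = 1 then (1 : L) else 0)).Local v), (((θ z).1).val : GL (Fin 3) (UnitaryGroup.LocalRing L v)) = y * ((endoEmbLocal L v z).val : GL (Fin 3) (UnitaryGroup.LocalRing L v)) * y⁻¹)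
    -- the dock's form relation `ᵗ(σy)·H′_v·y = a₀·Φ₃` (★ `exists_centralDock_form_of_fst_eq_smul_one`; ED. 1.5″ — the `hΔ0` payer's `halt` input ★ p842395 needs it)
    {a₀ : UnitaryGroup.LocalRing L v} (ha₀ : IsUnit a₀)
    (hy : formCongr (UnitaryGroup.conjLocal L (IsCMField.complexConj L) v) y ((UnitaryGroup.adelicForm L 3 H').map (UnitaryGroup.adeleToLocal L v)) =
      a₀ • (Matrix.of fun i j : Fin 3 => if i.val + j.val + 1 = 3 then (1 : UnitaryGroup.LocalRing L v) else 0))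
    {W : GL (Fin 3) (UnitaryGroup.LocalRing L v)} (hW : W.val = !![(1 : UnitaryGroup.LocalRing L v), 0, 0; 0, 0, 1; 0, 1, 0])
    {G₁ G₁' : Matrix (Fin 2) (Fin 2) (UnitaryGroup.LocalRing L v)} {G₂ G₂' : Matrix (Fin 1) (Fin 1) (UnitaryGroup.LocalRing L v)} {P' : GL (Fin (2 + 1)) (UnitaryGroup.LocalRing L v)}
    (hPW : twistGram (UnitaryGroup.conjLocal L (IsCMField.complexConj L) v) ((UnitaryGroup.adelicForm L 3 H').map (UnitaryGroup.adeleToLocal L v)) (y * W).val = UnitaryGroup.finSum 2 1 G₁ G₂)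
    (hP' : twistGram (UnitaryGroup.conjLocal L (IsCMField.complexConj L) v) ((UnitaryGroup.adelicForm L 3 H').map (UnitaryGroup.adeleToLocal L v)) P'.val = UnitaryGroup.finSum 2 1 G₁' G₂')
    (hnn : ¬ ∃ z : UnitaryGroup.LocalRing L v, IsUnit z ∧ G₁'.det = G₁.det * (UnitaryGroup.conjLocal L (IsCMField.complexConj L) v z * z)),
        ∀ ψ : ((UnitaryGroup.cmDatum L 3 H').Local v) → ℂ, IsLocSmooth ψ → ∃ V ∈ 𝓝 (⟨εH, Subgroup.mem_centralizer_singleton_iff.2 rfl⟩ : ↥(Subgroup.centralizer ({εH} : Set ((UnitaryGroup.cmDatum L 2 (Matrix.of fun i j : Fin 2 => if i.val + j.val + 1 = 2 then (1 : L) else 0)).Local v × (UnitaryGroup.cmDatum L 1 (Matrix.of fun i j : Fin 1 => if i.val + j.val + 1 = 1 then (1 : L) else 0)).Local v)))), ∀ t ∈ V, IsLocalGRegular L v (t : ((UnitaryGroup.cmDatum L 2 (Matrix.of fun i j : Fin 2 => if i.val + j.val + 1 = 2 then (1 : L) else 0)).Local v × (UnitaryGroup.cmDatum L 1 (Matrix.of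 fun i j : Fin 1 => if i.val + j.val + 1 = 1 then (1 : L) else 0)).Local v)) →
      (∑ᶠ c ∈ {c : ConjClasses ((UnitaryGroup.cmDatum L 3 H').Local v) | IsLocalGRegular L v (τ t) ∧ ∃ x : ((UnitaryGroup.cmDatum L 3 H').Local v), ∃ B : Matrix (Fin 2) (Fin 2) (UnitaryGroup.LocalRing L v),
          ((x * Quotient.out c * x⁻¹).val.val : Matrix (Fin 3) (Fin 3) (UnitaryGroup.LocalRing L v)) * P'.val = P'.val * UnitaryGroup.finSum 2 1 B (((τ t).2.val.val : Matrix (Fin 1) (Fin 1) (UnitaryGroup.LocalRing L v)))},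
        ((finExplicitCollection L H' μ (finExplicitDelta_conj_left_all L H' μ) (finExplicitDelta_conj_right_all L H' μ)) v).Δ (t : ((UnitaryGroup.cmDatum L 2 (Matrix.of fun i j : Fin 2 => if i.val + j.val + 1 = 2 then (1 : L) else 0)).Local v × (UnitaryGroup.cmDatum L 1 (Matrix.of fun i j : Fin 1 => if i.val + j.val + 1 = 1 then (1 : L) else 0)).Local v)) (Quotient.out c) * classOrbitalIntegral mG ψ c) = 0 := by
  intro L _ _ _ H' μ _ _ _ _ νH νG _ _ _ _ hμu hμω hherm hanis v hv _iH _bH _iG _bG mH mG hmH hmG φ hφ εH hsing hregA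
    εf τ hτc hτ₀ hεf₁ hεfu hτreg hτC P dg hP hdg0 hdg01 ht1 hτ1 hτ2 ε y θ hθε hθ a₀ ha₀ hy W hW G₁ G₁' G₂ G₂' P' hPW hP' hnn ψ hψ
  classical
  -- the place above `v`, its conjugation-invariance, `det H′ ≠ 0`, the dock read as `y ι(ε♭) y⁻¹ = ε`, the scalar `u = γ(ε_H)` off the `U(1)`-entry of `ε♭`
  obtain ⟨w⟩ := (inferInstance : Nonempty (UnitaryGroup.PlacesOver L v))
  have hw : IsCMField.complexConj L • w.1 = w.1 := smul_eq_of_subsingleton_placesOver₁₁ L hv w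
  have hdet' : H'.det ≠ 0 := det_ne_zero_of_anisotropic₁₁ L hanis
  have hyε : y * ((endoEmbLocal L v εf).val : GL (Fin 3) (UnitaryGroup.LocalRing L v)) * y⁻¹ = ε.val := by rw [← hθ εf, hθε]
  have hεfu' : (εf.2.val.val : Matrix (Fin 1) (Fin 1) (UnitaryGroup.LocalRing L v)) 0 0 ≠ finGammaTwo L v εH := hεfu
  -- `ι(↑t) ∼ ι(τ t)` in `GL₃`, hence the norm-pair transport `↑t ↦ τ t`
  have key : ∀ t : ↥(Subgroup.centralizer ({εH} : Set ((UnitaryGroup.cmDatum L 2 (Matrix.of fun i j : Fin 2 => if i.val + j.val + 1 = 2 then (1 : L) else 0)).Local v × (UnitaryGroup.cmDatum L 1 (Matrix.of fun i j : Fin 1 => if i.val + j.val + 1 = 1 then (1 : L) else 0)).Local v))),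
      IsConj ((endoEmbLocal L v (t : ((UnitaryGroup.cmDatum L 2 (Matrix.of fun i j : Fin 2 => if i.val + j.val + 1 = 2 then (1 : L) else 0)).Local v × (UnitaryGroup.cmDatum L 1 (Matrix.of fun i j : Fin 1 => if i.val + j.val + 1 = 1 then (1 : L) else 0)).Local v))).val : GL (Fin 3) (UnitaryGroup.LocalRing L v))
        ((endoEmbLocal L v (τ t)).val : GL (Fin 3) (UnitaryGroup.LocalRing L v)) := fun t => by
    rw [coe_endoEmbLocal, coe_endoEmbLocal]
    exact isConj_endoGL_of_frames P _ _ _ _ (ht1 t) rfl (hτ1 t) (by simp [hτ2 t])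
  have hnp : ∀ (t : ↥(Subgroup.centralizer ({εH} : Set ((UnitaryGroup.cmDatum L 2 (Matrix.of fun i j : Fin 2 => if i.val + j.val + 1 = 2 then (1 : L) else 0)).Local v × (UnitaryGroup.cmDatum L 1 (Matrix.of fun i j : Fin 1 => if i.val + j.val + 1 = 1 then (1 : L) else 0)).Local v))))
      (γ' : ((UnitaryGroup.cmDatum L 3 H').Local v)),
      IsLocalNormPair L H' v (t : ((UnitaryGroup.cmDatum L 2 (Matrix.of fun i j : Fin 2 => if i.val + j.val + 1 = 2 then (1 : L) else 0)).Local v × (UnitaryGroup.cmDatum L 1 (Matrix.of fun i j : Fin 1 => if i.val + j.val + 1 = 1 then (1 : L) else 0)).Local v)) γ' →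
        IsLocalNormPair L H' v (τ t) γ' :=
    fun t γ' hm => (key t).symm.trans hm
  -- (1) the compact dock `C′` with its carrier data, canonical family `m′`, base point `ε_C` and the descent `hD′` at the CENTRAL point `ε♭ = τ b₀`: ★ A-p14's S1 package
  obtain ⟨C', iGr, iTo, iTG, iCp, iLC, iSC, iT2, iMe, iBo, iMq, iBq, ν', iHa, iRI, P'', m', hm', εC, hD', -, -⟩ :=
    exists_compactSidePackage_of_badFrame L H' μ νH νG hμu hμω hherm hanis v hv mH mG hmH hmG φ hφ εf (finGammaTwo L v εH) hεf₁ hεfu'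
      ε y θ hθε hθ W hW G₁ G₁' G₂ G₂' P' hPW hP' hnn
  -- (2) `hD0′`: the descent read at the torus (pull back along `τ`, transport the matching by `key`)
  have hD0' : ∀ ψ : ((UnitaryGroup.cmDatum L 3 H').Local v) → ℂ, IsLocSmooth ψ → ∃ ψε : C' → ℂ, IsLocallyConstant ψε ∧
      ∀ B' ∈ 𝓝 εC, ∃ V ∈ 𝓝 (⟨εH, Subgroup.mem_centralizer_singleton_iff.2 rfl⟩ : ↥(Subgroup.centralizer ({εH} : Set ((UnitaryGroup.cmDatum L 2 (Matrix.of fun i j : Fin 2 => if i.val + j.val + 1 = 2 then (1 : L) else 0)).Local v × (UnitaryGroup.cmDatum L 1 (Matrix.of fun i j : Fin 1 => if i.val + j.val + 1 = 1 then (1 : L) else 0)).Local v)))),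
        ∀ t ∈ V, IsLocalGRegular L v (t : ((UnitaryGroup.cmDatum L 2 (Matrix.of fun i j : Fin 2 => if i.val + j.val + 1 = 2 then (1 : L) else 0)).Local v × (UnitaryGroup.cmDatum L 1 (Matrix.of fun i j : Fin 1 => if i.val + j.val + 1 = 1 then (1 : L) else 0)).Local v)) →
          ∀ c : ConjClasses ((UnitaryGroup.cmDatum L 3 H').Local v),
            (IsLocalGRegular L v (τ t) ∧ ∃ x : ((UnitaryGroup.cmDatum L 3 H').Local v), ∃ B : Matrix (Fin 2) (Fin 2) (UnitaryGroup.LocalRing L v),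
              ((x * Quotient.out c * x⁻¹).val.val : Matrix (Fin 3) (Fin 3) (UnitaryGroup.LocalRing L v)) * P'.val = P'.val * UnitaryGroup.finSum 2 1 B (((τ t).2.val.val : Matrix (Fin 1) (Fin 1) (UnitaryGroup.LocalRing L v)))) →
            IsLocalNormPair L H' v (t : ((UnitaryGroup.cmDatum L 2 (Matrix.of fun i j : Fin 2 => if i.val + j.val + 1 = 2 then (1 : L) else 0)).Local v × (UnitaryGroup.cmDatum L 1 (Matrix.of fun i j : Fin 1 => if i.val + j.val + 1 = 1 then (1 : L) else 0)).Local v)) (Quotient.out c) →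
              ∃ m ∈ B', P'' (Quotient.out (ConjClasses.mk m)) ∧ classOrbitalIntegral mG ψ c = classOrbitalIntegral m' ψε (ConjClasses.mk m) := by
    intro ψ₁ hψ₁
    obtain ⟨ψε, hψε, hD⟩ := hD' ψ₁ hψ₁
    refine ⟨ψε, hψε, fun B' hB' => ?_⟩
    obtain ⟨V₁, hV₁, hV₁D⟩ := hD B' hB'
    refine ⟨τ ⁻¹' V₁, hτc.continuousAt.preimage_mem_nhds (by rw [hτ₀]; exact hV₁), ?_⟩
    rintro t ht - c ⟨hτr, x, B, hxP⟩ hpair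
    exact hV₁D (τ t) ht hτr c ⟨x, B, hxP⟩ (hnp t _ hpair)
  -- (3) `hΔ0`: «ALL − GOOD» (★ F0P3-p01 FILE B) with `hsep′` ★, `hside`∕`hdisj` ★ at the base element `τ t`, `halt` ★ F0P3-p02 (form relation!), `hall` ★ FILE A
  have hΔ0 := exists_nhds_finsum_badSide_delta_eq_zero L H' v μ (finExplicitDelta_conj_left_all L H' μ) (finExplicitDelta_conj_right_all L H' μ) εH
    ⟨εH, Subgroup.mem_centralizer_singleton_iff.2 rfl⟩ ε θ εf τ hτc hτ₀
    (fun (t : ↥(Subgroup.centralizer ({εH} : Set ((UnitaryGroup.cmDatum L 2 (Matrix.of fun i j : Fin 2 => if i.val + j.val + 1 = 2 then (1 : L) else 0)).Local v × (UnitaryGroup.cmDatum L 1 (Matrix.of fun i j : Fin 1 => if i.val + j.val + 1 = 1 then (1 : L) else 0)).Local v)))) (g : ((UnitaryGroup.cmDatum L 3 H').Local v)) =>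
      IsLocalGRegular L v (τ t) ∧ ∃ x : ((UnitaryGroup.cmDatum L 3 H').Local v), ∃ B : Matrix (Fin 2) (Fin 2) (UnitaryGroup.LocalRing L v),
        ((x * g * x⁻¹).val.val : Matrix (Fin 3) (Fin 3) (UnitaryGroup.LocalRing L v)) * P'.val = P'.val * UnitaryGroup.finSum 2 1 B (((τ t).2.val.val : Matrix (Fin 1) (Fin 1) (UnitaryGroup.LocalRing L v))))
    (exists_nhds_stablySaturated_sep_dock w hw εf (finGammaTwo L v εH) hεf₁ hεfu' ε y θ hyε hθ)
    ⟨univ, univ_mem, fun t _ ht γ' hm => by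
      rcases side_of_dock L H' v w hw hherm hdet' εf (finGammaTwo L v εH) hεf₁ θ hθ hW hyε hPW hP' hnn (τ t) (hτreg t ht) γ' (hnp t γ' hm) with h | ⟨x, B, hx⟩
      · exact Or.inl h
      · exact Or.inr ⟨hτreg t ht, x, B, hx⟩⟩
    ⟨univ, univ_mem, fun t _ γ' hε hq => disj_of_dock L H' v θ hθ hW hPW hP' hnn (τ t) hq.1 γ' hε hq.2⟩
    (exists_nhds_stableClass_pair_delta_dock_eq_neg_of_frame L H' v w hw hherm hdet' μ _ _ εH P ht1 τ hτreg hτ1 hτ2 y θ hθ ha₀ hy _)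
    ⟨univ, univ_mem, fun t _ ht => finsum_finExplicitCollection_Δ_coe_out_eq_zero_of_torusFrame L H' v w hw μ _ _ hherm hdet' εH hP hdg0 hdg01 t ht⟩
  -- (4) the compact-side junction ★ F0P3-p01
  exact exists_nhds_finsum_side_eq_zero_of_compact_dock L H' v μ (finExplicitDelta_conj_left_all L H' μ) (finExplicitDelta_conj_right_all L H' μ) εH
    ⟨εH, Subgroup.mem_centralizer_singleton_iff.2 rfl⟩
    (fun (t : ↥(Subgroup.centralizer ({εH} : Set ((UnitaryGroup.cmDatum L 2 (Matrix.of fun i j : Fin 2 => if i.val + j.val + 1 = 2 then (1 : L) else 0)).Local v × (UnitaryGroup.cmDatum L 1 (Matrix.of fun i j : Fin 1 => if i.val + j.val + 1 = 1 then (1 : L) else 0)).Local v)))) (g : ((UnitaryGroup.cmDatum L 3 H').Local v)) =>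
      IsLocalGRegular L v (τ t) ∧ ∃ x : ((UnitaryGroup.cmDatum L 3 H').Local v), ∃ B : Matrix (Fin 2) (Fin 2) (UnitaryGroup.LocalRing L v),
        ((x * g * x⁻¹).val.val : Matrix (Fin 3) (Fin 3) (UnitaryGroup.LocalRing L v)) * P'.val = P'.val * UnitaryGroup.finSum 2 1 B (((τ t).2.val.val : Matrix (Fin 1) (Fin 1) (UnitaryGroup.LocalRing L v))))
    C' ν' P'' hm' εC hD0' hΔ0 ψ hψ

end Literature.NumberTheory.Rogawski1990

end
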